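import Mathlib
import HarnessLib
import Summits.ValiantsHypothesis.ValiantsHypothesis.Theorems.LacunarySymmetroidMatrixDescartesProductPlusOneSlopeMixedCloud

/-!
# LINE (A) `product_plus_one` — POLES ON BOTH SIDES: a switched knee-less (binomial) incoherent row is a log-convex PULL, so every
# one-hump W-cell holds against the three-type cloud {unswitched incoherent, switched coherent, switched incoherent binomial}

Crux item stmt-ValiantsHypothesis-18050, W-budget frame EB2-W (`WronskianBudgetK3`); W-CB dictionary (owner memo §17–§19, eng-11 W-COLUMN §5):
«one hump + poles anywhere, no slow bumps ⇒ ONE component».  Notation of ✓ `…CloudDefs` (`rowU`, `rowH`, `rowPsi1/2/3`, `cloudP1/2/3`).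

§1 `switchedPole_signs` — a switched incoherent BINOMIAL row `A − Bx^p` or `A − Cx^q` (`A > 0`, one upper letter zero, the other positive,
   value `< 0`: a pole BEHIND the window, i.e. to its left) has `ψ₁ > 0`, `ψ₃ > 0` and `ψ₂² ≤ ψ₁ψ₃`: its slope `−ψ₁` is a NEGATIVE, LOG-CONVEX pull
   (closed forms `ψ₁ = r²λA·u²`, `ψ₃ = r⁴λA·u²(6λA·u² + 1)`, `ψ₁ψ₃ − ψ₂² = 2r⁶λ³A³u⁶`, `λ` = the letter, `r` its rate, `u = 1/(A − λ)`).
   (A switched TRINOMIAL incoherent row is a riser, not a pull — ✓ `…SlopePhases`; only knee-less rows stay pulls after switching.)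
§2 `poleCloud_lcP1` — the THREE-type weighted cloud (every row, at the point, unswitched incoherent ∨ switched coherent ∨ switched incoherent binomial)
   has `P1 > 0` and `P2² ≤ P1·P3` (✓ `lc_sum`; types 1–2 = ✓ `mixedCloud_lcP1`).
§3 ★★ `hump_poleCloud_no_three_zeros` (✓ engine `slope_no_three_zeros_of_pull`) and its three instances
   `oneRiser_poleCloud_no_three_zeros` / `oneKnee_poleCloud_no_three_zeros` / `oneCoherent_poleCloud_no_three_zeros`:
   ONE hump (switched incoherent riser `a ≥ 0`, `b, c > 0` / one-signed binomial knee `a·c < 0`, `b = 0` / rising unswitched coherent row)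
   against the three-type cloud ⇒ `ψ₁ + cloudP1` has NO THREE ZEROS on the window — the ρ_I = 1 cells of ✓ `…SlopeMixedCloud` now also on INNER
   windows whose LEFT pole row is knee-less, with any number of further binomial poles behind.  LINE-currency wrappers: `…ProductPlusOnePoleCloudLine`.

HONEST FRAMING: one-hump cells; several humps / a trinomial pole on the left / slow bumps / `WronskianBudgetK3` / `OneChangeFloorK3` / the stubs /
18050 / `MatrixDescartes` OPEN; `VP ≠ VNP` is NOT proved.  No definitions, no named facts.
-/

set_option linter.dupNamespace false

namespace Summit.ValiantsHypothesis.ValiantsHypothesis.Theorems.LacunarySymmetroidMatrixDescartes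

namespace ProductPlusOne

open Finset
open scoped BigOperators

/-! ### §1 A switched binomial incoherent row is a log-convex pull -/

section Row

variable (e₁ e₂ : ℕ) (A B C : ℝ)

/-- **Bottom pole `A − Bx^p` past its zero:** closed forms of `ψ₁`, `ψ₂`, `ψ₃` (`C = 0`). [this file's lemma] -/
theorem switchedPole_bottom_eqs {x : ℝ} (hF : A - B * x ^ (e₁ + 1) - 0 * x ^ (e₁ + e₂ + 2) ≠ 0) :
    rowPsi1 e₁ e₂ A B 0 x = ((e₁ : ℝ) + 1) ^ 2 * (B * x ^ (e₁ + 1)) * A / (A - B * x ^ (e₁ + 1)) ^ 2 ∧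
    rowPsi2 e₁ e₂ A B 0 x = ((e₁ : ℝ) + 1) ^ 3 * (B * x ^ (e₁ + 1)) * A * (A + B * x ^ (e₁ + 1)) / (A - B * x ^ (e₁ + 1)) ^ 3 ∧
    rowPsi3 e₁ e₂ A B 0 x = ((e₁ : ℝ) + 1) ^ 4 * (B * x ^ (e₁ + 1)) * A
      * (6 * (B * x ^ (e₁ + 1)) * A + (A - B * x ^ (e₁ + 1)) ^ 2) / (A - B * x ^ (e₁ + 1)) ^ 4 := by
  have hF' : A - B * x ^ (e₁ + 1) ≠ 0 := by simpa using hF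
  unfold rowPsi1 rowPsi2 rowPsi3 rowH rowU
  refine ⟨?_, ?_, ?_⟩ <;> (simp only [mul_zero, zero_mul, add_zero, sub_zero]; field_simp; ring)

/-- **Top pole `A − Cx^q` past its zero:** closed forms of `ψ₁`, `ψ₂`, `ψ₃` (`B = 0`). [this file's lemma] -/
theorem switchedPole_top_eqs {x : ℝ} (hF : A - 0 * x ^ (e₁ + 1) - C * x ^ (e₁ + e₂ + 2) ≠ 0) :
    rowPsi1 e₁ e₂ A 0 C x = ((e₁ : ℝ) + e₂ + 2) ^ 2 * (C * x ^ (e₁ + e₂ + 2)) * A / (A - C * x ^ (e₁ + e₂ + 2)) ^ 2 ∧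
    rowPsi2 e₁ e₂ A 0 C x = ((e₁ : ℝ) + e₂ + 2) ^ 3 * (C * x ^ (e₁ + e₂ + 2)) * A * (A + C * x ^ (e₁ + e₂ + 2))
      / (A - C * x ^ (e₁ + e₂ + 2)) ^ 3 ∧
    rowPsi3 e₁ e₂ A 0 C x = ((e₁ : ℝ) + e₂ + 2) ^ 4 * (C * x ^ (e₁ + e₂ + 2)) * A
      * (6 * (C * x ^ (e₁ + e₂ + 2)) * A + (A - C * x ^ (e₁ + e₂ + 2)) ^ 2) / (A - C * x ^ (e₁ + e₂ + 2)) ^ 4 := by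
  have hF' : A - C * x ^ (e₁ + e₂ + 2) ≠ 0 := by simpa using hF
  unfold rowPsi1 rowPsi2 rowPsi3 rowH rowU
  refine ⟨?_, ?_, ?_⟩ <;> (simp only [mul_zero, zero_mul, zero_add, sub_zero]; field_simp; ring)

/-- ★ **A switched incoherent BINOMIAL row is a log-convex pull.**  `A > 0`, `B, C ≥ 0` with `B·C = 0` and `B + C > 0` (exactly one upper letter),
`x > 0`, value `A − Bx^p − Cx^q < 0`: then `ψ₁ > 0`, `ψ₃ > 0` and `ψ₂² ≤ ψ₁·ψ₃`. [this file's theorem] -/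
theorem switchedPole_signs {x : ℝ} (hx : 0 < x) (hA : 0 < A) (hB : 0 ≤ B) (hC : 0 ≤ C) (hBC : B * C = 0) (hpos : 0 < B + C)
    (hF : A - B * x ^ (e₁ + 1) - C * x ^ (e₁ + e₂ + 2) < 0) :
    0 < rowPsi1 e₁ e₂ A B C x ∧ 0 < rowPsi3 e₁ e₂ A B C x ∧
      rowPsi2 e₁ e₂ A B C x ^ 2 ≤ rowPsi1 e₁ e₂ A B C x * rowPsi3 e₁ e₂ A B C x := by
  rcases mul_eq_zero.1 hBC with hB0 | hC0
  · -- top pole `A − Cx^q`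
    subst hB0
    have hC' : 0 < C := by linarith
    obtain ⟨h1, h2, h3⟩ := switchedPole_top_eqs e₁ e₂ A C hF.ne
    set γ := C * x ^ (e₁ + e₂ + 2) with hγ
    set F := A - C * x ^ (e₁ + e₂ + 2) with hFdef
    have hγpos : 0 < γ := by positivity
    have hFne : F ≠ 0 := by rw [hFdef]; linarith
    have hF2 : 0 < F ^ 2 := by positivity
    set r := ((e₁ : ℝ) + e₂ + 2) with hr
    have hrpos : 0 < r := by rw [hr]; positivity
    have e1 : rowPsi1 e₁ e₂ A 0 C x = r ^ 2 * γ * A / F ^ 2 := h1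
    have e2 : rowPsi2 e₁ e₂ A 0 C x = r ^ 3 * γ * A * (A + γ) / F ^ 3 := h2
    have e3 : rowPsi3 e₁ e₂ A 0 C x = r ^ 4 * γ * A * (6 * γ * A + F ^ 2) / F ^ 4 := h3
    refine ⟨by rw [e1]; positivity, by rw [e3]; positivity, ?_⟩
    rw [e1, e2, e3]
    have hF4 : 0 < F ^ 4 := by positivity
    have hF6 : (F ^ 3) ^ 2 = F ^ 2 * F ^ 4 := by ring
    rw [div_pow, hF6, div_mul_div_comm]
    apply div_le_div_of_nonneg_right _ (by positivity)
    have hAγ : (A + γ) ^ 2 = F ^ 2 + 4 * γ * A := by rw [hFdef, hγ]; ring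
    calc (r ^ 3 * γ * A * (A + γ)) ^ 2 = r ^ 6 * γ ^ 2 * A ^ 2 * (F ^ 2 + 4 * γ * A) := by
          rw [show (r ^ 3 * γ * A * (A + γ)) ^ 2 = r ^ 6 * γ ^ 2 * A ^ 2 * (A + γ) ^ 2 by ring, hAγ]
      _ ≤ r ^ 6 * γ ^ 2 * A ^ 2 * (F ^ 2 + 4 * γ * A) + 2 * r ^ 6 * γ ^ 3 * A ^ 3 := le_add_of_nonneg_right (by positivity)
      _ = r ^ 2 * γ * A * (r ^ 4 * γ * A * (6 * γ * A + F ^ 2)) := by ring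
  · -- bottom pole `A − Bx^p`
    subst hC0
    have hB' : 0 < B := by linarith
    obtain ⟨h1, h2, h3⟩ := switchedPole_bottom_eqs e₁ e₂ A B hF.ne
    set β := B * x ^ (e₁ + 1) with hβ
    set F := A - B * x ^ (e₁ + 1) with hFdef
    have hβpos : 0 < β := by positivity
    have hFne : F ≠ 0 := by rw [hFdef]; linarith
    have hF2 : 0 < F ^ 2 := by positivity
    set r := ((e₁ : ℝ) + 1) with hr
    have hrpos : 0 < r := by rw [hr]; positivity
    have e1 : rowPsi1 e₁ e₂ A B 0 x = r ^ 2 * β * A / F ^ 2 := h1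
    have e2 : rowPsi2 e₁ e₂ A B 0 x = r ^ 3 * β * A * (A + β) / F ^ 3 := h2
    have e3 : rowPsi3 e₁ e₂ A B 0 x = r ^ 4 * β * A * (6 * β * A + F ^ 2) / F ^ 4 := h3
    refine ⟨by rw [e1]; positivity, by rw [e3]; positivity, ?_⟩
    rw [e1, e2, e3]
    have hF4 : 0 < F ^ 4 := by positivity
    have hF6 : (F ^ 3) ^ 2 = F ^ 2 * F ^ 4 := by ring
    rw [div_pow, hF6, div_mul_div_comm]
    apply div_le_div_of_nonneg_right _ (by positivity)
    have hAβ : (A + β) ^ 2 = F ^ 2 + 4 * β * A := by rw [hFdef, hβ]; ring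
    calc (r ^ 3 * β * A * (A + β)) ^ 2 = r ^ 6 * β ^ 2 * A ^ 2 * (F ^ 2 + 4 * β * A) := by
          rw [show (r ^ 3 * β * A * (A + β)) ^ 2 = r ^ 6 * β ^ 2 * A ^ 2 * (A + β) ^ 2 by ring, hAβ]
      _ ≤ r ^ 6 * β ^ 2 * A ^ 2 * (F ^ 2 + 4 * β * A) + 2 * r ^ 6 * β ^ 3 * A ^ 3 := le_add_of_nonneg_right (by positivity)
      _ = r ^ 2 * β * A * (r ^ 4 * β * A * (6 * β * A + F ^ 2)) := by ring

end Row

/-! ### §2 The three-type cloud is a log-convex pull -/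

section Cloud

variable (e₁ e₂ : ℕ) {ι : Type*} {s : Finset ι} {m A B C : ι → ℝ}

/-- **Pole cloud, signs and log-convexity.**  Every row of `s` is, at `x > 0`, either an unswitched incoherent row (`B_i, C_i ≥ 0`, `B_i + C_i > 0`,
value `> 0`), or a switched coherent row (`A_i > 0`, `B_i < 0 < C_i`, value `< 0`), or a switched incoherent BINOMIAL row (`A_i > 0`, `B_i, C_i ≥ 0`,
`B_i·C_i = 0`, `B_i + C_i > 0`, value `< 0`); weights `m_i > 0`, `s` nonempty: `P1 > 0` and `P2² ≤ P1·P3`. [this file's theorem] -/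
theorem poleCloud_lcP1 {x : ℝ} (hx : 0 < x) (hs : s.Nonempty) (hm : ∀ i ∈ s, 0 < m i)
    (hrow : ∀ i ∈ s, (0 ≤ B i ∧ 0 ≤ C i ∧ 0 < B i + C i ∧ 0 < A i - B i * x ^ (e₁ + 1) - C i * x ^ (e₁ + e₂ + 2))
      ∨ (0 < A i ∧ B i < 0 ∧ 0 < C i ∧ A i - B i * x ^ (e₁ + 1) - C i * x ^ (e₁ + e₂ + 2) < 0)
      ∨ (0 < A i ∧ 0 ≤ B i ∧ 0 ≤ C i ∧ B i * C i = 0 ∧ 0 < B i + C i ∧ A i - B i * x ^ (e₁ + 1) - C i * x ^ (e₁ + e₂ + 2) < 0)) :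
    0 < cloudP1 e₁ e₂ s m A B C x ∧ cloudP2 e₁ e₂ s m A B C x ^ 2 ≤ cloudP1 e₁ e₂ s m A B C x * cloudP3 e₁ e₂ s m A B C x := by
  have hψ : ∀ i ∈ s, 0 < rowPsi1 e₁ e₂ (A i) (B i) (C i) x ∧ 0 ≤ rowPsi3 e₁ e₂ (A i) (B i) (C i) x ∧
      rowPsi2 e₁ e₂ (A i) (B i) (C i) x ^ 2 ≤ rowPsi1 e₁ e₂ (A i) (B i) (C i) x * rowPsi3 e₁ e₂ (A i) (B i) (C i) x := by
    intro i hi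
    rcases hrow i hi with ⟨hB, hC, hBC, hF⟩ | ⟨hA, hB, hC, hF⟩ | ⟨hA, hB, hC, hBC, hpos, hF⟩
    · exact ⟨(rowPsi_signs e₁ e₂ (A i) (B i) (C i) hx hB hC hBC hF).2.1, rowPsi3_nonneg e₁ e₂ hx hB hC hF,
        puller_slope_logConvex e₁ e₂ (A i) (B i) (C i) hx hB hC hF⟩
    · exact ⟨switchedCoherent_rowPsi1_pos e₁ e₂ (A i) (B i) (C i) hx hA hB hC hF,
        (switchedCoherent_rowPsi3_pos e₁ e₂ (A i) (B i) (C i) hx hA hB hC hF).le,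
        (switchedCoherent_slope_logConvex e₁ e₂ (A i) (B i) (C i) hx hA hB hC hF).le⟩
    · obtain ⟨h1, h3, hlc⟩ := switchedPole_signs e₁ e₂ (A i) (B i) (C i) hx hA hB hC hBC hpos hF
      exact ⟨h1, h3.le, hlc⟩
  refine ⟨?_, ?_⟩
  · unfold cloudP1
    exact Finset.sum_pos (fun i hi => mul_pos (hm i hi) (hψ i hi).1) hs
  · unfold cloudP1 cloudP2 cloudP3
    refine lc_sum s _ _ _ (fun i hi => mul_nonneg (hm i hi).le (hψ i hi).1.le)
      (fun i hi => mul_nonneg (hm i hi).le (hψ i hi).2.1) ?_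
    intro i hi
    have h := (hψ i hi).2.2
    have hm2 : 0 ≤ m i ^ 2 := sq_nonneg _
    calc (m i * rowPsi2 e₁ e₂ (A i) (B i) (C i) x) ^ 2 = m i ^ 2 * rowPsi2 e₁ e₂ (A i) (B i) (C i) x ^ 2 := by ring
      _ ≤ m i ^ 2 * (rowPsi1 e₁ e₂ (A i) (B i) (C i) x * rowPsi3 e₁ e₂ (A i) (B i) (C i) x) := mul_le_mul_of_nonneg_left h hm2
      _ = m i * rowPsi1 e₁ e₂ (A i) (B i) (C i) x * (m i * rowPsi3 e₁ e₂ (A i) (B i) (C i) x) := by ring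

end Cloud

/-! ### §3 The one-hump cells against the pole cloud -/

/-- ★★ **HUMP versus POLE CLOUD.**  Row `a − bx^p − cx^q` non-vanishing with rising (`ψ₁ < 0`), strictly log-concave slope on `[x₁, x₃] ⊂ (0,∞)`; nonempty
weighted three-type cloud (unswitched incoherent ∨ switched coherent ∨ switched incoherent binomial, pointwise on the window) ⇒ `ψ₁ + cloudP1` has no three
zeros. [this file's theorem] -/
theorem hump_poleCloud_no_three_zeros (e₁ e₂ : ℕ) (a b c : ℝ)
    {ι : Type*} (s : Finset ι) (hs : s.Nonempty) (m A B C : ι → ℝ) (hm : ∀ i ∈ s, 0 < m i)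
    {x₁ x₂ x₃ : ℝ} (h0 : 0 < x₁) (h12 : x₁ < x₂) (h23 : x₂ < x₃)
    (hF : ∀ x ∈ Set.Icc x₁ x₃, a - b * x ^ (e₁ + 1) - c * x ^ (e₁ + e₂ + 2) ≠ 0)
    (hpost : ∀ x ∈ Set.Icc x₁ x₃, rowPsi1 e₁ e₂ a b c x < 0)
    (hlc : ∀ x ∈ Set.Icc x₁ x₃, rowPsi1 e₁ e₂ a b c x * rowPsi3 e₁ e₂ a b c x < rowPsi2 e₁ e₂ a b c x ^ 2)
    (hrow : ∀ x ∈ Set.Icc x₁ x₃, ∀ i ∈ s, (0 ≤ B i ∧ 0 ≤ C i ∧ 0 < B i + C i ∧ 0 < A i - B i * x ^ (e₁ + 1) - C i * x ^ (e₁ + e₂ + 2))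
      ∨ (0 < A i ∧ B i < 0 ∧ 0 < C i ∧ A i - B i * x ^ (e₁ + 1) - C i * x ^ (e₁ + e₂ + 2) < 0)
      ∨ (0 < A i ∧ 0 ≤ B i ∧ 0 ≤ C i ∧ B i * C i = 0 ∧ 0 < B i + C i ∧ A i - B i * x ^ (e₁ + 1) - C i * x ^ (e₁ + e₂ + 2) < 0))
    (hzero : ∀ x ∈ ({x₁, x₂, x₃} : Set ℝ), rowPsi1 e₁ e₂ a b c x + cloudP1 e₁ e₂ s m A B C x = 0) : False := by
  have hx0 : ∀ x ∈ Set.Icc x₁ x₃, 0 < x := fun x hx => h0.trans_le hx.1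
  have hne : ∀ x ∈ Set.Icc x₁ x₃, ∀ i ∈ s, A i - B i * x ^ (e₁ + 1) - C i * x ^ (e₁ + e₂ + 2) ≠ 0 := by
    intro x hx i hi
    rcases hrow x hx i hi with ⟨_, _, _, h⟩ | ⟨_, _, _, h⟩ | ⟨_, _, _, _, _, h⟩
    · exact h.ne'
    · exact h.ne
    · exact h.ne
  exact slope_no_three_zeros_of_pull e₁ e₂ a b c (cloudP1 e₁ e₂ s m A B C) (cloudP2 e₁ e₂ s m A B C) (cloudP3 e₁ e₂ s m A B C)
    h0 h12 h23 hF hpost hlc (fun x hx => (poleCloud_lcP1 e₁ e₂ (hx0 x hx) hs hm (hrow x hx)).1)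
    (fun x hx => mixedCloud_hasDerivAt1 e₁ e₂ s m A B C (hx0 x hx) (hne x hx))
    (fun x hx => mixedCloud_hasDerivAt2 e₁ e₂ s m A B C (hx0 x hx) (hne x hx))
    (fun x hx => (poleCloud_lcP1 e₁ e₂ (hx0 x hx) hs hm (hrow x hx)).2) hzero

/-- ★★ **The switched incoherent RISER against the pole cloud** (`a ≥ 0`, `b, c > 0`, riser switched on the window): `ψ₁ + cloudP1` has no three zeros —
the ρ_I = 1 cell on an inner window with knee-less poles behind it. [this file's theorem] -/
theorem oneRiser_poleCloud_no_three_zeros (e₁ e₂ : ℕ) {a b c : ℝ} (ha : 0 ≤ a) (hb : 0 < b) (hc : 0 < c)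
    {ι : Type*} (s : Finset ι) (hs : s.Nonempty) (m A B C : ι → ℝ) (hm : ∀ i ∈ s, 0 < m i)
    {x₁ x₂ x₃ : ℝ} (h0 : 0 < x₁) (h12 : x₁ < x₂) (h23 : x₂ < x₃)
    (hsw : ∀ x ∈ Set.Icc x₁ x₃, a - b * x ^ (e₁ + 1) - c * x ^ (e₁ + e₂ + 2) < 0)
    (hrow : ∀ x ∈ Set.Icc x₁ x₃, ∀ i ∈ s, (0 ≤ B i ∧ 0 ≤ C i ∧ 0 < B i + C i ∧ 0 < A i - B i * x ^ (e₁ + 1) - C i * x ^ (e₁ + e₂ + 2))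
      ∨ (0 < A i ∧ B i < 0 ∧ 0 < C i ∧ A i - B i * x ^ (e₁ + 1) - C i * x ^ (e₁ + e₂ + 2) < 0)
      ∨ (0 < A i ∧ 0 ≤ B i ∧ 0 ≤ C i ∧ B i * C i = 0 ∧ 0 < B i + C i ∧ A i - B i * x ^ (e₁ + 1) - C i * x ^ (e₁ + e₂ + 2) < 0))
    (hzero : ∀ x ∈ ({x₁, x₂, x₃} : Set ℝ), rowPsi1 e₁ e₂ a b c x + cloudP1 e₁ e₂ s m A B C x = 0) : False := by
  have hx0 : ∀ x ∈ Set.Icc x₁ x₃, 0 < x := fun x hx => h0.trans_le hx.1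
  have hI1 : x₁ ∈ Set.Icc x₁ x₃ := ⟨le_rfl, (h12.trans h23).le⟩
  have hP1 := (poleCloud_lcP1 e₁ e₂ (hx0 x₁ hI1) hs hm (hrow x₁ hI1)).1
  have hstart : rowPsi1 e₁ e₂ a b c x₁ < 0 := by linarith [hzero x₁ (by simp)]
  have hpost : ∀ x ∈ Set.Icc x₁ x₃, rowPsi1 e₁ e₂ a b c x < 0 := fun x hx =>
    (eq_or_lt_of_le hx.1).elim (fun h => h ▸ hstart)
      (fun h => riser_turning_persist e₁ e₂ a b c hb hc h0 (h12.trans h23).le hsw hstart.le x ⟨h, hx.2⟩)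
  exact hump_poleCloud_no_three_zeros e₁ e₂ a b c s hs m A B C hm h0 h12 h23 (fun x hx => (hsw x hx).ne) hpost
    (fun x hx => riser_slope_logConcave e₁ e₂ a b c (hx0 x hx) ha hb.le hc.le (hsw x hx) (hpost x hx)) hrow hzero

/-- ★★ **The one-signed binomial KNEE against the pole cloud** (`a·c < 0`, `b = 0` in normal form). [this file's theorem] -/
theorem oneKnee_poleCloud_no_three_zeros (e₁ e₂ : ℕ) {a c : ℝ} (hac : a * c < 0)
    {ι : Type*} (s : Finset ι) (hs : s.Nonempty) (m A B C : ι → ℝ) (hm : ∀ i ∈ s, 0 < m i)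
    {x₁ x₂ x₃ : ℝ} (h0 : 0 < x₁) (h12 : x₁ < x₂) (h23 : x₂ < x₃)
    (hrow : ∀ x ∈ Set.Icc x₁ x₃, ∀ i ∈ s, (0 ≤ B i ∧ 0 ≤ C i ∧ 0 < B i + C i ∧ 0 < A i - B i * x ^ (e₁ + 1) - C i * x ^ (e₁ + e₂ + 2))
      ∨ (0 < A i ∧ B i < 0 ∧ 0 < C i ∧ A i - B i * x ^ (e₁ + 1) - C i * x ^ (e₁ + e₂ + 2) < 0)
      ∨ (0 < A i ∧ 0 ≤ B i ∧ 0 ≤ C i ∧ B i * C i = 0 ∧ 0 < B i + C i ∧ A i - B i * x ^ (e₁ + 1) - C i * x ^ (e₁ + e₂ + 2) < 0))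
    (hzero : ∀ x ∈ ({x₁, x₂, x₃} : Set ℝ), rowPsi1 e₁ e₂ a 0 c x + cloudP1 e₁ e₂ s m A B C x = 0) : False := by
  have hx0 : ∀ x ∈ Set.Icc x₁ x₃, 0 < x := fun x hx => h0.trans_le hx.1
  have hF : ∀ x ∈ Set.Icc x₁ x₃, a - 0 * x ^ (e₁ + 1) - c * x ^ (e₁ + e₂ + 2) ≠ 0 := by
    intro x hx h
    have ha : a = c * x ^ (e₁ + e₂ + 2) := by linarith
    rw [ha] at hac
    have : 0 ≤ c * x ^ (e₁ + e₂ + 2) * c := by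
      have := sq_nonneg c; nlinarith [pow_pos (hx0 x hx) (e₁ + e₂ + 2)]
    linarith
  have hpost : ∀ x ∈ Set.Icc x₁ x₃, rowPsi1 e₁ e₂ a 0 c x < 0 := fun x hx => knee_rowPsi1_neg e₁ e₂ a c (hx0 x hx) hac
  exact hump_poleCloud_no_three_zeros e₁ e₂ a 0 c s hs m A B C hm h0 h12 h23 hF hpost
    (fun x hx => binomial_slope_logConcave e₁ e₂ a 0 c x (by ring) (hpost x hx)) hrow hzero

/-- ★★ **The rising unswitched COHERENT row against the pole cloud** (`a > 0`, `b ≤ 0 ≤ c`, value `> 0` and `ψ₁ < 0` on the window). [this file's theorem] -/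
theorem oneCoherent_poleCloud_no_three_zeros (e₁ e₂ : ℕ) {a b c : ℝ} (ha : 0 < a) (hb : b ≤ 0) (hc : 0 ≤ c)
    {ι : Type*} (s : Finset ι) (hs : s.Nonempty) (m A B C : ι → ℝ) (hm : ∀ i ∈ s, 0 < m i)
    {x₁ x₂ x₃ : ℝ} (h0 : 0 < x₁) (h12 : x₁ < x₂) (h23 : x₂ < x₃)
    (hun0 : ∀ x ∈ Set.Icc x₁ x₃, 0 < a - b * x ^ (e₁ + 1) - c * x ^ (e₁ + e₂ + 2))
    (hpost : ∀ x ∈ Set.Icc x₁ x₃, rowPsi1 e₁ e₂ a b c x < 0)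
    (hrow : ∀ x ∈ Set.Icc x₁ x₃, ∀ i ∈ s, (0 ≤ B i ∧ 0 ≤ C i ∧ 0 < B i + C i ∧ 0 < A i - B i * x ^ (e₁ + 1) - C i * x ^ (e₁ + e₂ + 2))
      ∨ (0 < A i ∧ B i < 0 ∧ 0 < C i ∧ A i - B i * x ^ (e₁ + 1) - C i * x ^ (e₁ + e₂ + 2) < 0)
      ∨ (0 < A i ∧ 0 ≤ B i ∧ 0 ≤ C i ∧ B i * C i = 0 ∧ 0 < B i + C i ∧ A i - B i * x ^ (e₁ + 1) - C i * x ^ (e₁ + e₂ + 2) < 0))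
    (hzero : ∀ x ∈ ({x₁, x₂, x₃} : Set ℝ), rowPsi1 e₁ e₂ a b c x + cloudP1 e₁ e₂ s m A B C x = 0) : False :=
  hump_poleCloud_no_three_zeros e₁ e₂ a b c s hs m A B C hm h0 h12 h23 (fun x hx => (hun0 x hx).ne') hpost
    (fun x hx => coherent_slope_logConcave e₁ e₂ a b c (h0.trans_le hx.1) ha hb hc (hun0 x hx) (hpost x hx)) hrow hzero

end ProductPlusOne

end Summit.ValiantsHypothesis.ValiantsHypothesis.Theorems.LacunarySymmetroidMatrixDescartes
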